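import Literature.NumberTheory.LFunctions.ZetaScrewGrowthMomentsProofs
import Literature.Analysis.Complex.PringsheimNonnegativeCoefficients
import Mathlib.Analysis.Complex.TaylorSeries
import Mathlib.Algebra.Order.Antidiag.Prod
import Mathlib.Topology.Algebra.InfiniteSum.Real
import HarnessLib

/-!
# Suzuki's Theorem 1.8 in positive-semidefinite form: the Hankel forms of the moments `μ_n`
# and the Riemann hypothesis (proofs)

LINE 1 — LABEL: RH-EQUIVALENT·PRINTED criterion (Suzuki2023 Thm 1.8), proved here AS AN
EQUIVALENCE in its robust positive-semidefinite form
(`riemannHypothesis_iff_posSemidef_zetaScrewHankel`); the new direction is the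
RH-FREE door "all Hankel forms of `(μ_n)` positive semidefinite `⟹` RH"
(`riemannHypothesis_of_posSemidef_zetaScrewHankel`). bears_on: LADDER-RH B-C/B-P
(COLUMN 6 DBR; the moments `μ_n` of COLUMN 1's screw function `Ψ`; `λ_n ↔ μ_n` = COLUMN 4 LI via
Thm 8.1). WHAT THIS IS NOT: not progress toward RH — nobody has shown these Hankel forms positive
semidefinite; proving the criterion fixes WHICH positivity statement would prove RH, it does not
move RH; nothing here bears on the truth of RH.

Proof-only companion (D-0014; no definitions, no named facts) of
`Literature/NumberTheory/LFunctions/ZetaScrewGrowthMoments.lean` (`Suzuki2023_thm18`,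
`zetaScrewMoment`, `zetaScrewHankel`, `zetaScrewHankelShift`) and of §§D, E, H of
`ZetaScrewGrowthMomentsProofs.lean`, following M. Suzuki, *Aspects of the screw function
corresponding to the Riemann zeta-function*, J. Lond. Math. Soc. (2) 108 (2023) = arXiv:2206.03682
[Suzuki2023], Thm 1.8 (pp. 3–4) and §7.3 (p. 17).

## The statement proved, and its relation to the printed Thm 1.8

Printed (Thm 1.8): "the RH is true if and only if `det Δ_n ≥ 0` and `det Δ_n^{(1)} ≥ 0` for all
`n ∈ ℤ_{>0}`", `Δ_n = (μ_{i+j})_{i,j ≤ n}`, `Δ_n^{(1)} = (μ_{i+j+1})_{i,j ≤ n}`,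
`μ_n = ∫₀^∞ 4^{-1}e^{-t/2}Ψ(t)tⁿdt` (1.13). Printed proof of `⟸` (§7.3): "the sign conditions make
`{μ_n}` a Stieltjes moment sequence of some measure on `[0,∞)` [KrNu77]", then determinacy of the
Stieltjes moment problem from `4^{-1}e^{-t/2}Ψ(t) ≪ e^{-c√t}` [Lin17], and Thm 1.7.

What is proved here is the criterion with the hypothesis in the form in which Stieltjes'
theorem actually delivers a moment sequence — POSITIVE SEMIDEFINITENESS OF THE HANKEL FORMS
(equivalently, by `ZetaScrewGrowth.hankel_quadForm_eq`, Stieltjes positivity of the moment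
functional: `∫ 4^{-1}e^{-t/2}Ψ(t)q(t)²dt ≥ 0` and `∫ 4^{-1}e^{-t/2}Ψ(t)·t·q(t)²dt ≥ 0` for every real
polynomial `q`):

  `RiemannHypothesis ↔ ∀ n, (Δ_n).PosSemidef ∧ (Δ_n^{(1)}).PosSemidef`.

The `⟹` half is the tree's `ZetaScrewGrowth.posSemidef_zetaScrewHankel(_Shift)_of_RH` (§E of the
sibling file, the printed argument: under RH `Ψ ≥ 0`). Non-negativity of the leading determinants
`det Δ_n`, `det Δ_n^{(1)}` (`n ≥ 1`) alone does not make a general real sequence a Stieltjes moment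
sequence (for a degenerate sequence the leading minors can vanish while a form is indefinite), so
the typed fact `Suzuki2023_thm18` (hypothesis verbatim as printed) is NOT discharged by this file
and stays a named fact; the present theorem is the robust reading of Thm 1.8.

## The proof of `⟸` (deviation from print: no moment problem, no determinacy)

Let `R(X) = (1-2X)^{-2}(ξ'/ξ)(1-X)`; by (1.15) (tree `zetaScrewMoment_eq_iteratedDeriv`)
`μ_k = R^{(k)}(0)`, and `R` is holomorphic on every disc `D(x, 1/2)` with real centre `x ≤ 0`
(`ξ(1-X) ≠ 0` for `|Im X| < 1/2` since the zeros have `|Im ρ| > 14`, tree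
`FordL33.fourteen_lt_abs_im`; `1 - 2X ≠ 0` for `Re X < 1/2`): `differentiableOn_R_ball`.

1. **Propagation (§1, pure analysis).** Say `P(x)` holds if the numbers `R^{(k)}(x)` are real and
   all Hankel forms `∑_{u,v<N} a_u a_v R^{(s+u+v)}(x)` (every shift `s`, every `N`) are `≥ 0`. If
   `F` is holomorphic on `D(x, r)` and `P(x)` holds for `F`, then `P(x+y)` holds for every real
   `|y| < r` (`hankelPos_shift`): by Taylor (Mathlib `Complex.hasSum_taylorSeries_on_ball`)
   `F^{(m)}(x+y) = ∑ₙ yⁿ/n!·F^{(m+n)}(x)`, absolutely convergent because the coefficients are `≥ 0`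
   and the series at `x+|y|` converges; and with `c_p = (y/2)^p/p!`,
   `∑_{u,v} a_u a_v F^{(s+u+v)}(x+y) = lim_{N'} ∑_{i,j} b_i b_j F^{(s+i+j)}(x)`,
   `b = a ⋆ (c_p)_{p<N'}` — a limit of Hankel forms at `x` (`hankelForm_convVec`), each `≥ 0` — where
   the limit is the convergence of the square partial sums of the absolutely summable double family
   `c_p c_q F^{(m+p+q)}(x)` (`tendsto_sq_partialSum`: `∑_{p+q=n} c_p c_q = yⁿ/n!`, Mathlib's
   `sigmaAntidiagonalEquivProd`). This is the only place where positivity is transported; it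
   replaces the Stieltjes moment problem of the printed proof.
2. **`P(0)`** is the hypothesis (the shift-`s` forms are forms of `Δ` or `Δ^{(1)}` on zero-padded
   vectors: `hankelPos_moments`), hence `P(x)` for all real `x ≤ 0` by induction in steps `< 1/2`
   (`hankelPos_R_of_nonpos`). In particular `R^{(k)}(x₁) ≥ 0` for all `k` at every `x₁ ≤ 0`.
3. **Vivanti–Pringsheim (§3).** `R` is analytic at every real point of `[x₁, 1/2)` (`ξ` has no
   real zeros), so by the tree's segment form of the Vivanti–Pringsheim theorem
   (`Literature.Analysis.Complex.summable_mul_pow_of_nonneg_of_analyticAt` [Titchmarsh1939, §7.21])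
   the Taylor series of `R` at `x₁` converges on the whole disc `D(x₁, 1/2 - x₁)`; its sum `g`
   satisfies `g(X)(1-2X)²ξ(1-X) = ξ'(1-X)` on that disc (identity theorem from `D(x₁, 1/2)`).
4. **Order clash.** If `ξ(ρ₀) = 0` with `Re ρ₀ > 1/2`, choose `x₁ ≪ 0` with
   `|(1-ρ₀) - x₁| < 1/2 - x₁`; at `X₀ = 1 - ρ₀` the relation of step 3 gives
   `ord ξ' ≥ ord ξ = ord ξ' + 1` — impossible (`riemannXi_ne_zero_of_derivs_nonneg`, the argument of
   `ZetaScrewGrowth.riemannXi_ne_zero_of_laplace`). RH follows by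
   `quasiRiemannHypothesis_one_half_iff_holds`.

Everything in this file is proved; there are no definitions and no named facts.

## References

* M. Suzuki, J. Lond. Math. Soc. (2) 108 (2023), no. 4, 1448–1487; arXiv:2206.03682, Thm 1.8
  (pp. 3–4), (1.13), (1.15), §7.3 (p. 17). [Suzuki2023]
* E. C. Titchmarsh, *The Theory of Functions*, 2nd ed., Oxford 1939, §7.21 (Vivanti–Pringsheim).
  [Titchmarsh1939]
* J. A. Shohat, J. D. Tamarkin, *The Problem of Moments*, AMS 1943, Thm 1.3 (Stieltjes' theorem:
  positive semidefinite Hankel forms). [folklore background; not used in the proofs]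
-/

noncomputable section

open Complex Filter Topology Finset
open scoped Real Nat

namespace Literature.NumberTheory.LFunctions

namespace ZetaScrewThm18

/-! ### 1.1 Taylor series of iterated derivatives -/

/-- `(F^{(m)})^{(n)} = F^{(m+n)}`. [folklore] -/
private theorem iteratedDeriv_iteratedDeriv_eq (n m : ℕ) (F : ℂ → ℂ) :
    iteratedDeriv n (iteratedDeriv m F) = iteratedDeriv (m + n) F := by
  rw [iteratedDeriv_eq_iterate, iteratedDeriv_eq_iterate, iteratedDeriv_eq_iterate,
    ← Function.iterate_add_apply, Nat.add_comm n m]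

/-- Taylor expansion of `F^{(m)}` at the centre of a ball of differentiability. [folklore] -/
private theorem hasSum_taylor_iteratedDeriv {F : ℂ → ℂ} {c : ℂ} {r : ℝ}
    (hF : DifferentiableOn ℂ F (Metric.ball c r)) {z : ℂ} (hz : z ∈ Metric.ball c r) (m : ℕ) :
    HasSum (fun n : ℕ ↦ (n ! : ℂ)⁻¹ * (z - c) ^ n * iteratedDeriv (m + n) F c)
      (iteratedDeriv m F z) := by
  have hFm : DifferentiableOn ℂ (iteratedDeriv m F) (Metric.ball c r) := by
    rw [iteratedDeriv_eq_iterate]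
    exact ((hF.analyticOnNhd Metric.isOpen_ball).iterated_deriv m).differentiableOn
  have h := Complex.hasSum_taylorSeries_on_ball hFm hz
  refine h.congr_fun fun n ↦ ?_
  rw [iteratedDeriv_iteratedDeriv_eq, smul_eq_mul, smul_eq_mul, mul_assoc]

/-! ### 1.2 Real centres -/

/-- At a real centre with real Taylor coefficients, the Taylor series at a real point is a real
series and the value is real. [folklore] -/
private theorem hasSum_re_taylor {F : ℂ → ℂ} {x r : ℝ} (hF : DifferentiableOn ℂ F (Metric.ball (x : ℂ) r))
    (him : ∀ k, (iteratedDeriv k F x).im = 0) {y : ℝ} (hy : |y| < r) (m : ℕ) :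
    HasSum (fun n : ℕ ↦ (n ! : ℝ)⁻¹ * y ^ n * (iteratedDeriv (m + n) F x).re)
      (iteratedDeriv m F ((x + y : ℝ) : ℂ)).re ∧
    (iteratedDeriv m F ((x + y : ℝ) : ℂ)).im = 0 := by
  have hz : ((x + y : ℝ) : ℂ) ∈ Metric.ball (x : ℂ) r := by
    rw [Metric.mem_ball, dist_eq_norm]
    push_cast
    rw [add_sub_cancel_left, Complex.norm_real, Real.norm_eq_abs]
    exact hy
  have h := hasSum_taylor_iteratedDeriv hF hz m
  have hterm : ∀ n : ℕ, (n ! : ℂ)⁻¹ * (((x + y : ℝ) : ℂ) - x) ^ n * iteratedDeriv (m + n) F x =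
      ((((n ! : ℝ)⁻¹ * y ^ n : ℝ)) : ℂ) * iteratedDeriv (m + n) F x := by
    intro n
    push_cast
    ring
  simp_rw [hterm] at h
  have hre := Complex.hasSum_re h
  have him' := Complex.hasSum_im h
  simp only [Complex.re_ofReal_mul, Complex.im_ofReal_mul, him, mul_zero] at hre him'
  exact ⟨hre, him'.unique hasSum_zero⟩

/-- With non-negative real Taylor coefficients the real Taylor series converge absolutely inside
the ball. [folklore] -/
private theorem summable_abs_taylor {F : ℂ → ℂ} {x r : ℝ} (hF : DifferentiableOn ℂ F (Metric.ball (x : ℂ) r))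
    (him : ∀ k, (iteratedDeriv k F x).im = 0) {y : ℝ} (hy : |y| < r) (m : ℕ) :
    Summable (fun n : ℕ ↦ (n ! : ℝ)⁻¹ * |y| ^ n * (iteratedDeriv (m + n) F x).re) := by
  have hy' : |(|y|)| < r := by rwa [abs_abs]
  exact (hasSum_re_taylor hF him hy' m).1.summable

/-! ### 1.3 The square trick: Hankel positivity survives a Taylor shift -/

/-- `∑_{p+q=n} t^p/p! · t^q/q! = (2t)^n/n!`. [folklore] -/
private theorem sum_antidiagonal_taylorWeight (t : ℝ) (n : ℕ) :
    ∑ pq ∈ antidiagonal n, ((pq.1 ! : ℝ)⁻¹ * t ^ pq.1) * ((pq.2 ! : ℝ)⁻¹ * t ^ pq.2) =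
      (n ! : ℝ)⁻¹ * (2 * t) ^ n := by
  have h2 : (2 * t) ^ n = ∑ pq ∈ antidiagonal n, (n.choose pq.1 : ℝ) * (t ^ pq.1 * t ^ pq.2) := by
    rw [two_mul, (Commute.all t t).add_pow']
    refine Finset.sum_congr rfl fun pq _ ↦ ?_
    rw [nsmul_eq_mul]
  rw [h2, Finset.mul_sum]
  refine Finset.sum_congr rfl fun pq hpq ↦ ?_
  rw [HasAntidiagonal.mem_antidiagonal] at hpq
  have hfac : ((pq.1 + pq.2).choose pq.2 : ℝ) * (pq.1 ! : ℝ) * (pq.2 ! : ℝ) = ((pq.1 + pq.2)! : ℝ) := by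
    exact_mod_cast Nat.add_choose_mul_factorial_mul_factorial pq.1 pq.2
  rw [← hpq, Nat.choose_symm_add]
  have h1 : (pq.1 ! : ℝ) ≠ 0 := by positivity
  have h2' : (pq.2 ! : ℝ) ≠ 0 := by positivity
  have h3 : ((pq.1 + pq.2)! : ℝ) ≠ 0 := by positivity
  field_simp
  rw [← hfac]
  ring

/-- A linear form against the convolution vector `b = a ⋆ c` (truncated). [folklore] -/
private theorem sum_convVec_mul (a c w : ℕ → ℝ) (N N' : ℕ) :
    ∑ j ∈ range (N + N'),
        (∑ v ∈ range N, ∑ q ∈ range N', if v + q = j then a v * c q else 0) * w j =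
      ∑ v ∈ range N, ∑ q ∈ range N', a v * c q * w (v + q) := by
  have hstep : ∀ j ∈ range (N + N'),
      (∑ v ∈ range N, ∑ q ∈ range N', if v + q = j then a v * c q else 0) * w j =
        ∑ v ∈ range N, ∑ q ∈ range N', if v + q = j then a v * c q * w j else 0 := by
    intro j _
    rw [Finset.sum_mul]
    refine Finset.sum_congr rfl fun v _ ↦ ?_
    rw [Finset.sum_mul]
    refine Finset.sum_congr rfl fun q _ ↦ ?_
    split_ifs <;> simp
  rw [Finset.sum_congr rfl hstep, Finset.sum_comm]
  refine Finset.sum_congr rfl fun v hv ↦ ?_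
  rw [Finset.sum_comm]
  refine Finset.sum_congr rfl fun q hq ↦ ?_
  rw [Finset.sum_ite_eq]
  rw [Finset.mem_range] at hv hq
  rw [if_pos (Finset.mem_range.2 (by omega))]

/-- Expansion of the Hankel form of the convolution vector. [folklore] -/
private theorem hankelForm_convVec (a c D : ℕ → ℝ) (s N N' : ℕ) :
    ∑ i ∈ range (N + N'), ∑ j ∈ range (N + N'),
        (∑ u ∈ range N, ∑ p ∈ range N', if u + p = i then a u * c p else 0) *
        (∑ v ∈ range N, ∑ q ∈ range N', if v + q = j then a v * c q else 0) * D (s + i + j) =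
      ∑ u ∈ range N, ∑ v ∈ range N, a u * a v *
        ∑ p ∈ range N', ∑ q ∈ range N', c p * c q * D (s + u + v + (p + q)) := by
  have h1 : ∀ i ∈ range (N + N'),
      ∑ j ∈ range (N + N'),
        (∑ u ∈ range N, ∑ p ∈ range N', if u + p = i then a u * c p else 0) *
        (∑ v ∈ range N, ∑ q ∈ range N', if v + q = j then a v * c q else 0) * D (s + i + j) =
      (∑ u ∈ range N, ∑ p ∈ range N', if u + p = i then a u * c p else 0) *
        ∑ v ∈ range N, ∑ q ∈ range N', a v * c q * D (s + i + (v + q)) := by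
    intro i _
    rw [← sum_convVec_mul a c (fun j ↦ D (s + i + j)) N N', Finset.mul_sum]
    refine Finset.sum_congr rfl fun j _ ↦ ?_
    ring
  rw [Finset.sum_congr rfl h1,
    sum_convVec_mul a c (fun i ↦ ∑ v ∈ range N, ∑ q ∈ range N', a v * c q * D (s + i + (v + q))) N N']
  -- now: ∑ u ∑ p a u c p ∑ v ∑ q a v c q D(s+(u+p)+(v+q)) = ∑ u ∑ v a u a v ∑ p ∑ q c p c q D(…)
  refine Finset.sum_congr rfl fun u _ ↦ ?_
  simp_rw [Finset.mul_sum]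
  rw [Finset.sum_comm]
  refine Finset.sum_congr rfl fun v _ ↦ Finset.sum_congr rfl fun p _ ↦
    Finset.sum_congr rfl fun q _ ↦ ?_
  rw [show s + (u + p) + (v + q) = s + u + v + (p + q) by omega]
  ring

/-- **Square partial sums.** For `D ≥ 0` with `∑ |y|ⁿ/n! · D(m+n) < ∞`, the square partial sums of
`c_p c_q D(m+p+q)`, `c_p = (y/2)^p/p!`, tend to `∑ yⁿ/n! · D(m+n)`. [folklore] -/
private theorem tendsto_sq_partialSum (D : ℕ → ℝ) (y : ℝ) (hD : ∀ k, 0 ≤ D k) (m : ℕ)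
    (hsum : Summable (fun n : ℕ ↦ (n ! : ℝ)⁻¹ * |y| ^ n * D (m + n))) :
    Tendsto (fun N' : ℕ ↦ ∑ p ∈ range N', ∑ q ∈ range N',
        ((p ! : ℝ)⁻¹ * (y / 2) ^ p) * ((q ! : ℝ)⁻¹ * (y / 2) ^ q) * D (m + (p + q)))
      atTop (𝓝 (∑' n : ℕ, (n ! : ℝ)⁻¹ * y ^ n * D (m + n))) := by
  set G : ℕ × ℕ → ℝ := fun pq ↦
    ((pq.1 ! : ℝ)⁻¹ * (y / 2) ^ pq.1) * ((pq.2 ! : ℝ)⁻¹ * (y / 2) ^ pq.2) * D (m + (pq.1 + pq.2))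
    with hG
  set e := (Finset.HasAntidiagonal.sigmaAntidiagonalEquivProd (A := ℕ)) with he
  have he_apply : ∀ x : (Σ n : ℕ, antidiagonal n), e x = (x.2 : ℕ × ℕ) := fun x ↦ rfl
  -- fibre sums over the antidiagonals
  have hfib : ∀ (t : ℝ) (n : ℕ),
      ∑ pq ∈ antidiagonal n, ((pq.1 ! : ℝ)⁻¹ * t ^ pq.1) * ((pq.2 ! : ℝ)⁻¹ * t ^ pq.2) *
        D (m + (pq.1 + pq.2)) = (n ! : ℝ)⁻¹ * (2 * t) ^ n * D (m + n) := by
    intro t n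
    rw [← sum_antidiagonal_taylorWeight, Finset.sum_mul]
    refine Finset.sum_congr rfl fun pq hpq ↦ ?_
    rw [HasAntidiagonal.mem_antidiagonal] at hpq
    rw [hpq]
  -- Step 1: `|G|` is summable
  have habs : ∀ pq : ℕ × ℕ, |G pq| =
      ((pq.1 ! : ℝ)⁻¹ * (|y| / 2) ^ pq.1) * ((pq.2 ! : ℝ)⁻¹ * (|y| / 2) ^ pq.2) *
        D (m + (pq.1 + pq.2)) := by
    intro pq
    simp only [hG, abs_mul, abs_inv, abs_pow, abs_div, Nat.abs_cast, abs_two,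
      abs_of_nonneg (hD _)]
  have hGabs : Summable (fun pq : ℕ × ℕ ↦ |G pq|) := by
    rw [← e.summable_iff]
    refine (summable_sigma_of_nonneg (fun x ↦ abs_nonneg _)).2
      ⟨fun n ↦ (hasSum_fintype _).summable, ?_⟩
    have hfib' : ∀ n : ℕ, ∑' c : antidiagonal n, (fun x : (Σ n : ℕ, antidiagonal n) ↦ |G (e x)|) ⟨n, c⟩ =
        (n ! : ℝ)⁻¹ * |y| ^ n * D (m + n) := by
      intro n
      rw [tsum_fintype]
      simp only [he_apply, habs]
      rw [Finset.sum_coe_sort (antidiagonal n)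
        (fun pq : ℕ × ℕ ↦ ((pq.1 ! : ℝ)⁻¹ * (|y| / 2) ^ pq.1) * ((pq.2 ! : ℝ)⁻¹ * (|y| / 2) ^ pq.2) *
          D (m + (pq.1 + pq.2))), hfib]
      congr 2
      ring
    simp_rw [hfib']
    exact hsum
  have hGsum : Summable G := hGabs.of_abs
  -- Step 2: the sum of `G` is `∑ yⁿ/n! D(m+n)`
  have h2 : HasSum (fun n : ℕ ↦ (n ! : ℝ)⁻¹ * y ^ n * D (m + n)) (∑' pq, G pq) := by
    have hG' : HasSum (G ∘ e) (∑' pq, G pq) := e.hasSum_iff.2 hGsum.hasSum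
    refine (hG'.sigma fun n ↦ hasSum_fintype _).congr_fun fun n ↦ ?_
    simp only [Function.comp_apply, he_apply]
    rw [Finset.sum_coe_sort (antidiagonal n) G, hG, hfib]
    congr 2
    ring
  -- Step 3: square partial sums
  have h3 : Tendsto (fun N' : ℕ ↦ ∑ pq ∈ range N' ×ˢ range N', G pq) atTop (𝓝 (∑' pq, G pq)) := by
    have ht : Tendsto (fun N' : ℕ ↦ range N' ×ˢ range N') atTop atTop := by
      refine tendsto_atTop_finset_of_monotone (fun a b hab ↦ ?_) (fun pq ↦ ?_)
      · exact Finset.product_subset_product (range_subset_range.2 hab) (range_subset_range.2 hab)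
      · refine ⟨max pq.1 pq.2 + 1, ?_⟩
        simp only [Finset.mem_product, Finset.mem_range]
        omega
    exact hGsum.hasSum.comp ht
  rw [h2.tsum_eq]
  refine h3.congr fun N' ↦ ?_
  rw [Finset.sum_product]

/-- **The square trick.** If the Hankel forms (all shifts) of a sequence `D ≥ 0` are positive
semidefinite and `∑ |y|ⁿ/n! · D(m+n) < ∞` for every `m`, then the Hankel forms of the shifted
sequence `T(m) = ∑ yⁿ/n! · D(m+n)` are positive semidefinite. (The step of our proof of
Suzuki2023 Thm 1.8 `⟸` that replaces the printed Stieltjes-moment-problem step [KrNu77]/[Lin17] of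
§7.3: positivity is transported by re-expansion, as in Titchmarsh's proof of Vivanti–Pringsheim.)
[cite: Suzuki2023, §7.3 (proof of Thm 1.8); Titchmarsh1939, §7.21] -/
theorem hankelPos_of_summable_shift (D : ℕ → ℝ) (y : ℝ) (hD : ∀ k, 0 ≤ D k)
    (hsum : ∀ m, Summable (fun n : ℕ ↦ (n ! : ℝ)⁻¹ * |y| ^ n * D (m + n)))
    (hpos : ∀ (s N : ℕ) (a : ℕ → ℝ), 0 ≤ ∑ u ∈ range N, ∑ v ∈ range N, a u * a v * D (s + u + v))
    (s N : ℕ) (a : ℕ → ℝ) :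
    0 ≤ ∑ u ∈ range N, ∑ v ∈ range N,
      a u * a v * ∑' n : ℕ, (n ! : ℝ)⁻¹ * y ^ n * D (s + u + v + n) := by
  set c : ℕ → ℝ := fun p ↦ (p ! : ℝ)⁻¹ * (y / 2) ^ p with hc
  -- the truncated forms are Hankel forms of convolution vectors, hence `≥ 0`
  have hQ : ∀ N' : ℕ, 0 ≤ ∑ u ∈ range N, ∑ v ∈ range N, a u * a v *
      ∑ p ∈ range N', ∑ q ∈ range N', c p * c q * D (s + u + v + (p + q)) := by
    intro N'
    rw [← hankelForm_convVec a c D s N N']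
    exact hpos s (N + N') _
  -- and they converge to the form of `T`
  have hlim : Tendsto (fun N' : ℕ ↦ ∑ u ∈ range N, ∑ v ∈ range N, a u * a v *
      ∑ p ∈ range N', ∑ q ∈ range N', c p * c q * D (s + u + v + (p + q))) atTop
      (𝓝 (∑ u ∈ range N, ∑ v ∈ range N,
        a u * a v * ∑' n : ℕ, (n ! : ℝ)⁻¹ * y ^ n * D (s + u + v + n))) := by
    refine tendsto_finsetSum _ fun u _ ↦ tendsto_finsetSum _ fun v _ ↦ ?_
    exact (tendsto_sq_partialSum D y hD (s + u + v) (hsum _)).const_mul _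
  exact ge_of_tendsto' hlim hQ

/-! ### 1.4 Propagation of Hankel positivity along the real axis -/

/-- **Propagation lemma.** Let `F` be differentiable on the disc `D(x, r)` (`x` real) with real
Taylor coefficients at `x` whose Hankel forms (all shifts) are positive semidefinite. Then the same
holds at every real point `x + y`, `|y| < r`. (The propagation step of our proof of Suzuki2023
Thm 1.8 `⟸`, replacing the printed appeal to the Stieltjes moment problem [KrNu77] and its
determinacy [Lin17] in §7.3.) [cite: Suzuki2023, §7.3 (proof of Thm 1.8); Titchmarsh1939, §7.21] -/
theorem hankelPos_shift {F : ℂ → ℂ} {x r : ℝ} (hF : DifferentiableOn ℂ F (Metric.ball (x : ℂ) r))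
    (him : ∀ k, (iteratedDeriv k F x).im = 0)
    (hpos : ∀ (s N : ℕ) (a : ℕ → ℝ),
      0 ≤ ∑ u ∈ range N, ∑ v ∈ range N, a u * a v * (iteratedDeriv (s + u + v) F x).re)
    {y : ℝ} (hy : |y| < r) :
    (∀ k, (iteratedDeriv k F ((x + y : ℝ) : ℂ)).im = 0) ∧
    ∀ (s N : ℕ) (a : ℕ → ℝ), 0 ≤ ∑ u ∈ range N, ∑ v ∈ range N,
      a u * a v * (iteratedDeriv (s + u + v) F ((x + y : ℝ) : ℂ)).re := by
  have hnn : ∀ k, 0 ≤ (iteratedDeriv k F x).re := fun k ↦ by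
    simpa using hpos k 1 (fun _ ↦ 1)
  refine ⟨fun k ↦ (hasSum_re_taylor hF him hy k).2, fun s N a ↦ ?_⟩
  have h := hankelPos_of_summable_shift (fun k ↦ (iteratedDeriv k F x).re) y hnn
    (fun m ↦ summable_abs_taylor hF him hy m) hpos s N a
  refine h.trans_eq (Finset.sum_congr rfl fun u _ ↦ Finset.sum_congr rfl fun v _ ↦ ?_)
  rw [(hasSum_re_taylor hF him hy (s + u + v)).1.tsum_eq]

/-! ### 2. The function `R(X) = (1-2X)^{-2}(ξ'/ξ)(1-X)` on the discs `D(x, 1/2)`, `x ≤ 0` -/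

/-- `ξ(1 - X) ≠ 0` whenever `|Im X| ≤ 14` (the non-trivial zeros have `|Im ρ| > 14`,
tree `FordL33.fourteen_lt_abs_im`). [folklore] -/
private theorem riemannXi_one_sub_ne_zero_of_abs_im_le {X : ℂ} (hX : |X.im| ≤ 14) :
    riemannXi (1 - X) ≠ 0 := by
  intro h
  obtain ⟨hζ, h0, h1, -⟩ := riemannXi_zero_prop h
  have hmem : (1 - X) ∈ ZetaZeros.riemannZetaNontrivialZeros :=
    ZetaZeros.riemannZetaNontrivialZeros.mem_iff'.2 ⟨hζ, h0, h1⟩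
  have h14 := FordL33.fourteen_lt_abs_im ⟨1 - X, hmem⟩
  simp only [Complex.sub_im, Complex.one_im, zero_sub, abs_neg] at h14
  linarith

/-- For real `x ≤ 0`, `R` is complex differentiable on the disc `D(x, 1/2)` (no zeros of
`ξ(1 - X)` with `|Im X| < 1/2`, and `Re X < 1/2` there). [cite: Suzuki2023, (1.15), p. 4] -/
theorem differentiableOn_R_ball {x : ℝ} (hx : x ≤ 0) :
    DifferentiableOn ℂ
      (fun X : ℂ ↦ 1 / (1 - 2 * X) ^ 2 * (deriv riemannXi (1 - X) / riemannXi (1 - X)))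
      (Metric.ball (x : ℂ) (1 / 2)) := by
  intro X hX
  rw [Metric.mem_ball, dist_eq_norm] at hX
  have hre : |(X - x).re| < 1 / 2 := (Complex.abs_re_le_norm _).trans_lt hX
  have him : |(X - x).im| < 1 / 2 := (Complex.abs_im_le_norm _).trans_lt hX
  simp only [Complex.sub_re, Complex.ofReal_re, Complex.sub_im, Complex.ofReal_im, sub_zero]
    at hre him
  have h1 : riemannXi (1 - X) ≠ 0 := riemannXi_one_sub_ne_zero_of_abs_im_le (by linarith)
  have h2 : (1 : ℂ) - 2 * X ≠ 0 := by
    intro h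
    have := congrArg Complex.re h
    simp at this
    rw [abs_lt] at hre
    linarith
  exact (ZetaScrewMomentDeriv.analyticOnNhd_R X ⟨h1, h2⟩).differentiableAt.differentiableWithinAt

/-- The Taylor coefficients of `R` at `0` are real: they are the moments `μ_k` ((1.15), tree
`zetaScrewMoment_eq_iteratedDeriv`). [cite: Suzuki2023, (1.15), p. 4] -/
theorem im_iteratedDeriv_R_zero (k : ℕ) :
    (iteratedDeriv k
      (fun X : ℂ ↦ 1 / (1 - 2 * X) ^ 2 * (deriv riemannXi (1 - X) / riemannXi (1 - X)))
      ((0 : ℝ) : ℂ)).im = 0 := by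
  rw [Complex.ofReal_zero, ← zetaScrewMoment_eq_iteratedDeriv, Complex.ofReal_im]

/-- `Re R^{(k)}(0) = μ_k` ((1.15)). [cite: Suzuki2023, (1.15), p. 4] -/
theorem re_iteratedDeriv_R_zero (k : ℕ) :
    (iteratedDeriv k
      (fun X : ℂ ↦ 1 / (1 - 2 * X) ^ 2 * (deriv riemannXi (1 - X) / riemannXi (1 - X)))
      ((0 : ℝ) : ℂ)).re = zetaScrewMoment k := by
  rw [Complex.ofReal_zero, ← zetaScrewMoment_eq_iteratedDeriv, Complex.ofReal_re]

/-- Padding a vector: a sum over `range K` of a vector supported on `[m, m+N)`. [folklore] -/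
private theorem sum_range_pad (m N K : ℕ) (hK : m + N ≤ K) (a w : ℕ → ℝ) :
    ∑ i ∈ range K, (if m ≤ i ∧ i < m + N then a (i - m) else 0) * w i =
      ∑ u ∈ range N, a u * w (m + u) := by
  have hsub : Finset.Ico m (m + N) ⊆ Finset.range K := fun i hi ↦ by
    rw [Finset.mem_Ico] at hi
    exact Finset.mem_range.2 (by omega)
  rw [← Finset.sum_subset hsub]
  · rw [Finset.sum_Ico_eq_sum_range, Nat.add_sub_cancel_left]
    refine Finset.sum_congr rfl fun u hu ↦ ?_
    rw [Finset.mem_range] at hu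
    rw [if_pos ⟨by omega, by omega⟩, Nat.add_sub_cancel_left]
  · intro i _ hi
    rw [Finset.mem_Ico] at hi
    rw [if_neg (by omega), zero_mul]

/-- **Hankel positivity at `X = 0`.** If all `Δ_n` and `Δ_n^{(1)}` are positive semidefinite, every
Hankel form `∑_{u,v<N} a_u a_v μ_{s+u+v}` (any shift `s`) is `≥ 0`: the shift-`s` form is the
form of `Δ` (even `s`) or `Δ^{(1)}` (odd `s`) on a zero-padded vector. [cite: Suzuki2023, Thm 1.8 / §7.3] -/
theorem hankelPos_moments
    (hΔ : ∀ n, (zetaScrewHankel n).PosSemidef) (hΔ1 : ∀ n, (zetaScrewHankelShift n).PosSemidef)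
    (s N : ℕ) (a : ℕ → ℝ) :
    0 ≤ ∑ u ∈ range N, ∑ v ∈ range N, a u * a v * zetaScrewMoment (s + u + v) := by
  obtain ⟨m, e, he, hs⟩ : ∃ m e : ℕ, e ≤ 1 ∧ s = 2 * m + e := ⟨s / 2, s % 2, by omega, by omega⟩
  set n : ℕ := m + N with hn
  set g : ℕ → ℝ := fun i ↦ if m ≤ i ∧ i < m + N then a (i - m) else 0 with hg
  -- the quadratic form of a Hankel matrix `(μ_{i+j+e})` on the padded vector
  have main : ∀ M : Matrix (Fin (n + 1)) (Fin (n + 1)) ℝ, M.PosSemidef →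
      (∀ i j : Fin (n + 1), M i j = zetaScrewMoment ((i : ℕ) + (j : ℕ) + e)) →
      0 ≤ ∑ u ∈ range N, ∑ v ∈ range N, a u * a v * zetaScrewMoment (s + u + v) := by
    intro M hM hentry
    have h0 := hM.dotProduct_mulVec_nonneg (fun i ↦ g i)
    simp only [dotProduct, Matrix.mulVec, Pi.star_apply, star_trivial, hentry] at h0
    -- convert the `Fin` sums to `range` sums
    have hconv : ∑ i : Fin (n + 1), g i * ∑ j : Fin (n + 1), zetaScrewMoment ((i : ℕ) + (j : ℕ) + e) * g j =
        ∑ i ∈ range (n + 1), g i * ∑ j ∈ range (n + 1), zetaScrewMoment (i + j + e) * g j := by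
      rw [← Fin.sum_univ_eq_sum_range (fun i ↦ g i * ∑ j ∈ range (n + 1), zetaScrewMoment (i + j + e) * g j) (n + 1)]
      refine Finset.sum_congr rfl fun i _ ↦ ?_
      rw [← Fin.sum_univ_eq_sum_range (fun j ↦ zetaScrewMoment (i + j + e) * g j) (n + 1)]
    rw [hconv] at h0
    -- evaluate the padded sums
    have hinner : ∀ i : ℕ, ∑ j ∈ range (n + 1), zetaScrewMoment (i + j + e) * g j =
        ∑ v ∈ range N, a v * zetaScrewMoment (i + (m + v) + e) := by
      intro i
      have := sum_range_pad m N (n + 1) (by omega) a (fun j ↦ zetaScrewMoment (i + j + e))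
      rw [← this]
      refine Finset.sum_congr rfl fun j _ ↦ ?_
      rw [hg]
      ring
    simp_rw [hinner] at h0
    have houter := sum_range_pad m N (n + 1) (by omega) a
      (fun i ↦ ∑ v ∈ range N, a v * zetaScrewMoment (i + (m + v) + e))
    simp only [hg] at h0
    rw [houter] at h0
    refine h0.trans_eq (Finset.sum_congr rfl fun u _ ↦ ?_)
    rw [Finset.mul_sum]
    refine Finset.sum_congr rfl fun v _ ↦ ?_
    rw [show m + u + (m + v) + e = s + u + v by omega]
    ring
  rcases Nat.le_one_iff_eq_zero_or_eq_one.1 he with rfl | rfl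
  · exact main (zetaScrewHankel n) (hΔ n) (fun i j ↦ by simp [zetaScrewHankel_apply])
  · exact main (zetaScrewHankelShift n) (hΔ1 n) (fun i j ↦ by simp [zetaScrewHankelShift_apply])

/-- **Hankel positivity on the negative axis.** Under the positive-semidefiniteness of all `Δ_n`,
`Δ_n^{(1)}`, for every real `x ≤ 0` the numbers `R^{(k)}(x)` are real and all their Hankel forms
are positive semidefinite (induction along the axis in steps `< 1/2`, `hankelPos_shift` on the
discs `D(x', 1/2)`). [cite: Suzuki2023, Thm 1.8 / §7.3] -/
theorem hankelPos_R_of_nonpos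
    (hΔ : ∀ n, (zetaScrewHankel n).PosSemidef) (hΔ1 : ∀ n, (zetaScrewHankelShift n).PosSemidef)
    {x : ℝ} (hx : x ≤ 0) :
    (∀ k, (iteratedDeriv k
      (fun X : ℂ ↦ 1 / (1 - 2 * X) ^ 2 * (deriv riemannXi (1 - X) / riemannXi (1 - X))) x).im = 0) ∧
    ∀ (s N : ℕ) (a : ℕ → ℝ), 0 ≤ ∑ u ∈ range N, ∑ v ∈ range N, a u * a v *
      (iteratedDeriv (s + u + v)
        (fun X : ℂ ↦ 1 / (1 - 2 * X) ^ 2 * (deriv riemannXi (1 - X) / riemannXi (1 - X))) x).re := by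
  set R : ℂ → ℂ :=
    fun X : ℂ ↦ 1 / (1 - 2 * X) ^ 2 * (deriv riemannXi (1 - X) / riemannXi (1 - X)) with hR
  suffices H : ∀ n : ℕ, ∀ x : ℝ, -(n : ℝ) / 4 ≤ x → x ≤ 0 →
      (∀ k, (iteratedDeriv k R x).im = 0) ∧
      ∀ (s N : ℕ) (a : ℕ → ℝ), 0 ≤ ∑ u ∈ range N, ∑ v ∈ range N,
        a u * a v * (iteratedDeriv (s + u + v) R x).re by
    obtain ⟨n, hn⟩ := exists_nat_ge (-4 * x)
    exact H n x (by linarith) hx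
  intro n
  induction n with
  | zero =>
    intro x h1 h2
    have hx0 : x = 0 := by
      have : (-((0 : ℕ) : ℝ)) / 4 = 0 := by norm_num
      linarith
    subst hx0
    refine ⟨im_iteratedDeriv_R_zero, fun s N a ↦ ?_⟩
    refine (hankelPos_moments hΔ hΔ1 s N a).trans_eq
      (Finset.sum_congr rfl fun u _ ↦ Finset.sum_congr rfl fun v _ ↦ ?_)
    exact congrArg (a u * a v * ·) (re_iteratedDeriv_R_zero (s + u + v)).symm
  | succ n ih =>
    intro x h1 h2
    by_cases hcase : -(n : ℝ) / 4 ≤ x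
    · exact ih x hcase h2
    · have hn0 : -(n : ℝ) / 4 ≤ 0 := by
        have : (0 : ℝ) ≤ n := n.cast_nonneg
        linarith
      have hP := ih (-(n : ℝ) / 4) le_rfl hn0
      have hF := differentiableOn_R_ball hn0
      have hy : |x - (-(n : ℝ) / 4)| < 1 / 2 := by
        push_cast at h1
        rw [abs_lt]
        constructor <;> linarith
      have h := hankelPos_shift hF hP.1 hP.2 hy
      have hxx : -(n : ℝ) / 4 + (x - (-(n : ℝ) / 4)) = x := by ring
      rw [hxx] at h
      exact h

/-! ### 3. Vivanti–Pringsheim at `x₁` and the order clash at an off-line zero -/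

/-- **Continuation step.** If at a real `x₁ ≤ 0` all `R^{(k)}(x₁)` are real and `≥ 0`, then
`ξ(ρ) ≠ 0` for every `ρ` with `|(1 - ρ) - x₁| < 1/2 - x₁`: by Vivanti–Pringsheim (tree
`summable_mul_pow_of_nonneg_of_analyticAt`; `ξ` has no real zeros) the Taylor series of `R` at `x₁`
converges on the disc `D(x₁, 1/2 - x₁)` to an analytic `g` with `g(X)(1-2X)²ξ(1-X) = ξ'(1-X)`
there (identity theorem), and at `X₀ = 1 - ρ` the orders of vanishing clash
(`ord ξ' + 1 = ord ξ`). [cite: Suzuki2023, Thm 1.8 / §7.3; Titchmarsh1939, §7.21] -/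
theorem riemannXi_ne_zero_of_derivs_nonneg {x₁ : ℝ} (hx₁ : x₁ ≤ 0)
    (him : ∀ k, (iteratedDeriv k
      (fun X : ℂ ↦ 1 / (1 - 2 * X) ^ 2 * (deriv riemannXi (1 - X) / riemannXi (1 - X))) x₁).im = 0)
    (hnn : ∀ k, 0 ≤ (iteratedDeriv k
      (fun X : ℂ ↦ 1 / (1 - 2 * X) ^ 2 * (deriv riemannXi (1 - X) / riemannXi (1 - X))) x₁).re)
    {ρ : ℂ} (hρ : ‖(1 - ρ) - x₁‖ < 1 / 2 - x₁) : riemannXi ρ ≠ 0 := by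
  intro hzero
  set R : ℂ → ℂ :=
    fun X : ℂ ↦ 1 / (1 - 2 * X) ^ 2 * (deriv riemannXi (1 - X) / riemannXi (1 - X)) with hR
  set b : ℝ := 1 / 2 - x₁ with hb
  have hb2 : 1 / 2 ≤ b := by rw [hb]; linarith
  have hbpos : 0 < b := by linarith
  -- the Taylor coefficients at `x₁`
  set a : ℕ → ℝ := fun n ↦ (n ! : ℝ)⁻¹ * (iteratedDeriv n R x₁).re with ha
  have ha0 : ∀ n, 0 ≤ a n := fun n ↦ mul_nonneg (by positivity) (hnn n)
  have hreal : ∀ n, (((iteratedDeriv n R x₁).re : ℝ) : ℂ) = iteratedDeriv n R x₁ := fun n ↦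
    Complex.ext (by simp) (by simp [him n])
  -- `F(z) = R(x₁ + z)` is analytic on the real segment `[0, b)` (no real zeros of `ξ`)
  set F : ℂ → ℂ := fun z ↦ R ((x₁ : ℂ) + z) with hF
  have hFan : ∀ t : ℝ, 0 ≤ t → t < b → AnalyticAt ℂ F t := by
    intro t _ htb
    have h1 : riemannXi (1 - ((x₁ : ℂ) + t)) ≠ 0 := by
      have := ZetaScrewLandau.riemannXi_half_add_ofReal_ne_zero (1 / 2 - x₁ - t)
      convert this using 2
      push_cast
      ring
    have h2 : (1 : ℂ) - 2 * ((x₁ : ℂ) + t) ≠ 0 := by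
      intro h
      have := congrArg Complex.re h
      simp at this
      rw [hb] at htb
      linarith
    have hRa : AnalyticAt ℂ R ((x₁ : ℂ) + t) := ZetaScrewMomentDeriv.analyticOnNhd_R _ ⟨h1, h2⟩
    exact hRa.comp (analyticAt_const.add analyticAt_id)
  -- the germ: Taylor's formula on `D(x₁, 1/2)`
  have hdiff : DifferentiableOn ℂ R (Metric.ball (x₁ : ℂ) (1 / 2)) := differentiableOn_R_ball hx₁
  have htaylor : ∀ z : ℂ, ‖z‖ < 1 / 2 →
      HasSum (fun n ↦ (a n : ℂ) * z ^ n) (R ((x₁ : ℂ) + z)) := by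
    intro z hz
    have hz' : (x₁ : ℂ) + z ∈ Metric.ball (x₁ : ℂ) (1 / 2) := by
      rw [Metric.mem_ball, dist_eq_norm, add_sub_cancel_left]
      exact hz
    have h := hasSum_taylor_iteratedDeriv hdiff hz' 0
    simp only [zero_add, iteratedDeriv_zero, add_sub_cancel_left] at h
    refine h.congr_fun fun n ↦ ?_
    rw [ha]
    push_cast
    rw [hreal]
    ring
  have hgerm : ∀ t : ℝ, 0 < t → t < 1 / 2 → HasSum (fun n ↦ (a n : ℂ) * (t : ℂ) ^ n) (F t) := by
    intro t ht0 ht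
    have := htaylor (t : ℂ) (by rw [Complex.norm_real, Real.norm_eq_abs, abs_of_pos ht0]; exact ht)
    simpa only [hF] using this
  -- Vivanti–Pringsheim: `∑ aₙ tⁿ` converges on `[0, b)`
  have hsumm : ∀ t : ℝ, 0 ≤ t → t < b → Summable fun n ↦ a n * t ^ n := fun t ht0 htb ↦
    Literature.Analysis.Complex.summable_mul_pow_of_nonneg_of_analyticAt ha0 hFan
      (by norm_num : (0 : ℝ) < 1 / 2) hgerm ht0 htb
  -- hence the complex power series has radius `≥ b`; let `g` be its sum
  set p : FormalMultilinearSeries ℂ ℂ ℂ := FormalMultilinearSeries.ofScalars ℂ (fun n ↦ (a n : ℂ))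
    with hp
  have hmem : ∀ z : ℂ, ‖z‖ < b → z ∈ Metric.eball (0 : ℂ) p.radius := by
    intro z hz
    set t : ℝ := (‖z‖ + b) / 2 with ht
    have ht0 : 0 ≤ t := by positivity
    have htb : t < b := by rw [ht]; linarith
    have hzt : ‖z‖ < t := by rw [ht]; linarith
    have hrad : ENNReal.ofReal t ≤ p.radius :=
      Literature.Analysis.Complex.ofReal_le_radius_of_summable ha0 ht0 (hsumm t ht0 htb)
    rw [Metric.mem_eball, edist_zero_right, ← ofReal_norm]
    exact lt_of_lt_of_le (ENNReal.ofReal_lt_ofReal_iff_of_nonneg (norm_nonneg _) |>.2 hzt) hrad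
  have hrad_pos : 0 < p.radius := by
    have h0 : (0 : ℂ) ∈ Metric.eball (0 : ℂ) p.radius := hmem 0 (by simpa using hbpos)
    rw [Metric.mem_eball, edist_self] at h0
    exact h0
  have hps := p.hasFPowerSeriesOnBall hrad_pos
  have hg_sum : ∀ z : ℂ, ‖z‖ < b → HasSum (fun n ↦ (a n : ℂ) * z ^ n) (p.sum z) := by
    intro z hz
    have h := hps.hasSum (hmem z hz)
    rw [zero_add] at h
    simpa only [hp, Literature.Analysis.Complex.ofScalars_ofReal_apply] using h
  have hg_an : ∀ z : ℂ, ‖z‖ < b → AnalyticAt ℂ p.sum z := fun z hz ↦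
    hps.analyticAt_of_mem (hmem z hz)
  -- `g = R(x₁ + ·)` on `D(0, 1/2)`
  have hgR : ∀ z : ℂ, ‖z‖ < 1 / 2 → p.sum z = R ((x₁ : ℂ) + z) := fun z hz ↦
    (hg_sum z (lt_of_lt_of_le hz hb2)).unique (htaylor z hz)
  -- the relation `-Z' = g (1-2X)² Z`, `Z(z) = ξ(1 - x₁ - z)`, on the whole disc `D(0, b)`
  set Z : ℂ → ℂ := fun z ↦ riemannXi (1 - ((x₁ : ℂ) + z)) with hZ
  set G : ℂ → ℂ := fun z ↦ -(p.sum z * (1 - 2 * ((x₁ : ℂ) + z)) ^ 2) with hG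
  have hZd : Differentiable ℂ Z := differentiable_riemannXi.comp (by fun_prop)
  have hZa : ∀ z, AnalyticAt ℂ Z z := fun z ↦ hZd.analyticAt z
  have hderivZ : ∀ z, deriv Z z = -deriv riemannXi (1 - ((x₁ : ℂ) + z)) := by
    intro z
    have hZ' : Z = fun z ↦ riemannXi ((1 - (x₁ : ℂ)) - z) := by
      funext w
      simp only [hZ, sub_sub]
    rw [hZ', deriv_comp_const_sub, sub_sub]
  have hGa : ∀ z : ℂ, ‖z‖ < b → AnalyticAt ℂ G z := fun z hz ↦
    ((hg_an z hz).mul ((analyticAt_const.sub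
      (analyticAt_const.mul (analyticAt_const.add analyticAt_id))).pow 2)).neg
  have hrel : ∀ z ∈ Metric.ball (0 : ℂ) b, deriv Z z = G z * Z z := by
    have hEan : AnalyticOnNhd ℂ (fun z ↦ deriv Z z - G z * Z z) (Metric.ball (0 : ℂ) b) := by
      intro z hz
      rw [Metric.mem_ball, dist_zero_right] at hz
      exact (hZa z).deriv.sub ((hGa z hz).mul (hZa z))
    have hE0 : (fun z ↦ deriv Z z - G z * Z z) =ᶠ[𝓝 (0 : ℂ)] 0 := by
      filter_upwards [Metric.ball_mem_nhds (0 : ℂ) (by norm_num : (0 : ℝ) < 1 / 2)] with z hz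
      rw [Metric.mem_ball, dist_zero_right] at hz
      have h14 : |((x₁ : ℂ) + z).im| ≤ 14 := by
        have := (Complex.abs_im_le_norm z)
        simp only [Complex.add_im, Complex.ofReal_im, zero_add]
        linarith
      have h1 : riemannXi (1 - ((x₁ : ℂ) + z)) ≠ 0 := riemannXi_one_sub_ne_zero_of_abs_im_le h14
      have h2 : (1 : ℂ) - 2 * ((x₁ : ℂ) + z) ≠ 0 := by
        intro h
        have := congrArg Complex.re h
        have hre := (Complex.abs_re_le_norm z)
        simp at this
        rw [abs_le] at hre
        linarith
      simp only [Pi.zero_apply, hderivZ, hG]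
      rw [hgR z hz]
      simp only [hZ, hR]
      set A : ℂ := deriv riemannXi (1 - ((x₁ : ℂ) + z)) with hA
      set Bx : ℂ := riemannXi (1 - ((x₁ : ℂ) + z)) with hBx
      set C : ℂ := 1 - 2 * ((x₁ : ℂ) + z) with hC
      field_simp
      ring
    have := hEan.eqOn_zero_of_preconnected_of_eventuallyEq_zero
      (convex_ball (0 : ℂ) b).isPreconnected (Metric.mem_ball_self hbpos) hE0
    intro z hz
    have h := this hz
    simp only [Pi.zero_apply] at h
    linear_combination h
  -- the zero `ρ`: `z₀ = (1 - ρ) - x₁` lies in `D(0, b)` and `Z(z₀) = ξ(ρ) = 0`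
  set z₀ : ℂ := (1 - ρ) - x₁ with hz₀
  have hz₀b : z₀ ∈ Metric.ball (0 : ℂ) b := by
    rw [Metric.mem_ball, dist_zero_right]
    exact hρ
  have hZ0 : Z z₀ = 0 := by
    rw [hZ]
    dsimp only
    rw [hz₀, show (1 : ℂ) - ((x₁ : ℂ) + (1 - ρ - x₁)) = ρ by ring]
    exact hzero
  have hev : deriv Z =ᶠ[𝓝 z₀] G * Z := by
    filter_upwards [Metric.isOpen_ball.mem_nhds hz₀b] with z hz
    rw [Pi.mul_apply]
    exact hrel z hz
  have h1 : analyticOrderAt (deriv Z) z₀ + 1 = analyticOrderAt Z z₀ := by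
    have := (hZa z₀).analyticOrderAt_deriv_add_one
    simpa [hZ0] using this
  have h2 : analyticOrderAt (deriv Z) z₀ = analyticOrderAt G z₀ + analyticOrderAt Z z₀ := by
    rw [analyticOrderAt_congr hev, analyticOrderAt_mul (hGa z₀ (by simpa using hρ)) (hZa z₀)]
  rw [h2] at h1
  generalize hoZ : analyticOrderAt Z z₀ = oZ at h1
  generalize hoG : analyticOrderAt G z₀ = oG at h1
  cases oZ with
  | top =>
    have hloc : ∀ᶠ z in 𝓝 z₀, Z z = 0 := analyticOrderAt_eq_top.1 hoZ
    have hall : Set.EqOn Z 0 Set.univ :=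
      (hZd.differentiableOn.analyticOnNhd isOpen_univ).eqOn_zero_of_preconnected_of_eventuallyEq_zero
        isPreconnected_univ (Set.mem_univ z₀) hloc
    have h2' : Z (-(x₁ : ℂ) - 1) = 0 := hall (Set.mem_univ _)
    simp only [hZ] at h2'
    rw [show (1 : ℂ) - ((x₁ : ℂ) + (-(x₁ : ℂ) - 1)) = 2 by ring] at h2'
    exact riemannXi_ne_zero_of_one_le_re (s := 2) (by norm_num) h2'
  | coe n =>
    cases oG with
    | top => simp at h1
    | coe m =>
      have h' : (m + n + 1 : ℕ) = n := by exact_mod_cast h1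
      omega

end ZetaScrewThm18

/-! ### 4. Assembly -/

/-- RH-EQUIVALENT criterion, sufficiency half in its POSITIVE-SEMIDEFINITE form (line 1).
**If all Hankel matrices `Δ_n = (μ_{i+j})` and `Δ_n^{(1)} = (μ_{i+j+1})` of Suzuki's moments
(1.13) are positive semidefinite, the Riemann hypothesis holds.** This is the robust form of the
`⟸` half of Suzuki2023 Thm 1.8 (printed with the weaker hypothesis `det Δ_n ≥ 0`,
`det Δ_n^{(1)} ≥ 0`; the printed proof — "the sign conditions make `{μ_n}` a Stieltjes moment
sequence [KrNu77]", then determinacy [Lin17] and Thm 1.7 — is replaced by: Hankel positivity of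
`(R^{(k)}(x))_k` propagates from `x = 0` ((1.15): `μ_k = R^{(k)}(0)`) along the negative real axis
through absolutely convergent Taylor re-expansions (`hankelPos_shift`); at `x₁ ≪ 0`
Vivanti–Pringsheim continues `R` analytically to the disc `D(x₁, 1/2 - x₁)`, which contains
`1 - ρ₀` for a zero `ρ₀` off the critical line — contradiction by the order clash
(`riemannXi_ne_zero_of_derivs_nonneg`); no moment determinacy is used). WHAT THIS IS NOT: nobody
has shown these Hankel forms positive semidefinite; the theorem fixes WHICH positivity would
prove RH. [cite: Suzuki2023, Thm 1.8, pp. 3–4 and §7.3, p. 17] -/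
theorem riemannHypothesis_of_posSemidef_zetaScrewHankel
    (h : ∀ n : ℕ, (zetaScrewHankel n).PosSemidef ∧ (zetaScrewHankelShift n).PosSemidef) :
    RiemannHypothesis := by
  refine quasiRiemannHypothesis_one_half_iff_holds.1 fun s hζ h1 h2 ↦ ?_
  have hξ : riemannXi s = 0 := (riemannXi_eq_zero_iff_holds s).2 ⟨hζ, by linarith, h2⟩
  -- the base point `x₁`
  set δ : ℝ := s.re - 1 / 2 with hδ
  set γ : ℝ := s.im with hγ
  have hδ0 : 0 < δ := by rw [hδ]; linarith
  set B : ℝ := (γ ^ 2 + δ ^ 2) / (2 * δ) + 1 with hB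
  have hB1 : 1 ≤ B := by
    have : 0 ≤ (γ ^ 2 + δ ^ 2) / (2 * δ) := by positivity
    rw [hB]; linarith
  set x₁ : ℝ := 1 / 2 - B with hx₁
  have hx₁0 : x₁ ≤ 0 := by rw [hx₁]; linarith
  have hP := ZetaScrewThm18.hankelPos_R_of_nonpos (fun n ↦ (h n).1) (fun n ↦ (h n).2) hx₁0
  have hnn : ∀ k, 0 ≤ (iteratedDeriv k
      (fun X : ℂ ↦ 1 / (1 - 2 * X) ^ 2 * (deriv riemannXi (1 - X) / riemannXi (1 - X))) x₁).re :=
    fun k ↦ by simpa using hP.2 k 1 (fun _ ↦ 1)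
  refine ZetaScrewThm18.riemannXi_ne_zero_of_derivs_nonneg hx₁0 hP.1 hnn ?_ hξ
  -- `|(1 - s) - x₁|² = (B - δ)² + γ² = B² - 2δ < B² = (1/2 - x₁)²`
  have hBx : 1 / 2 - x₁ = B := by rw [hx₁]; ring
  rw [hBx]
  have h2δ : 2 * δ * ((γ ^ 2 + δ ^ 2) / (2 * δ)) = γ ^ 2 + δ ^ 2 := by
    field_simp
  have hkey : 2 * δ * B = γ ^ 2 + δ ^ 2 + 2 * δ := by
    rw [hB, mul_add, h2δ]
    ring
  have hnormsq : ‖(1 - s) - (x₁ : ℂ)‖ ^ 2 = (B - δ) ^ 2 + γ ^ 2 := by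
    rw [Complex.sq_norm, Complex.normSq_apply]
    simp only [Complex.sub_re, Complex.one_re, Complex.ofReal_re, Complex.sub_im, Complex.one_im,
      Complex.ofReal_im, sub_zero, zero_sub]
    rw [hx₁, hδ, hγ]
    ring
  have hlt : ‖(1 - s) - (x₁ : ℂ)‖ ^ 2 < B ^ 2 := by
    rw [hnormsq]
    nlinarith
  have hB0 : 0 ≤ B := by linarith
  exact (pow_lt_pow_iff_left₀ (norm_nonneg _) hB0 two_ne_zero).1 hlt

/-- RH-EQUIVALENT (line 1). **Suzuki2023 Thm 1.8 in positive-semidefinite form, both directions:**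
`RH ⟺` all Hankel matrices `Δ_n`, `Δ_n^{(1)}` of the moments `μ_n = ∫₀^∞ 4^{-1}e^{-t/2}Ψ(t)tⁿdt`
are positive semidefinite (`⟹`: tree `ZetaScrewGrowth.posSemidef_zetaScrewHankel(_Shift)_of_RH`,
the printed Stieltjes-moment argument; `⟸`: `riemannHypothesis_of_posSemidef_zetaScrewHankel`).
WHAT THIS IS NOT: a criterion, not a proof of RH; nothing here bears on the truth of RH.
[cite: Suzuki2023, Thm 1.8, pp. 3–4 and §7.3, p. 17] -/
theorem riemannHypothesis_iff_posSemidef_zetaScrewHankel :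
    RiemannHypothesis ↔
      ∀ n : ℕ, (zetaScrewHankel n).PosSemidef ∧ (zetaScrewHankelShift n).PosSemidef :=
  ⟨fun hRH n ↦ ⟨ZetaScrewGrowth.posSemidef_zetaScrewHankel_of_RH hRH n,
    ZetaScrewGrowth.posSemidef_zetaScrewHankelShift_of_RH hRH n⟩,
    riemannHypothesis_of_posSemidef_zetaScrewHankel⟩

/-- RH-EQUIVALENT (line 1). **Thm 1.8 as Stieltjes positivity of the Hankel forms** (quadratic-form
wording of `riemannHypothesis_iff_posSemidef_zetaScrewHankel`, matching the tree's
`ZetaScrewGrowth.hankel_quadForm_nonneg_of_RH`): `RH ⟺ ∑ᵢⱼ xᵢ μ_{i+j+s} xⱼ ≥ 0` for all real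
vectors `x` and `s ∈ {0, 1}`. WHAT THIS IS NOT: a criterion, not a proof of RH.
[cite: Suzuki2023, Thm 1.8, pp. 3–4 and §7.3, p. 17] -/
theorem riemannHypothesis_iff_hankelForms_nonneg :
    RiemannHypothesis ↔ ∀ (n s : ℕ) (x : Fin (n + 1) → ℝ), s ≤ 1 →
      0 ≤ ∑ i : Fin (n + 1), ∑ j : Fin (n + 1),
        x i * zetaScrewMoment ((i : ℕ) + (j : ℕ) + s) * x j := by
  refine ⟨fun hRH n s x _ ↦ ZetaScrewGrowth.hankel_quadForm_nonneg_of_RH hRH n s x, fun h ↦ ?_⟩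
  refine riemannHypothesis_of_posSemidef_zetaScrewHankel fun n ↦ ⟨?_, ?_⟩
  · refine Matrix.PosSemidef.of_dotProduct_mulVec_nonneg
      (ZetaScrewGrowth.isHermitian_zetaScrewHankel n) fun x ↦ ?_
    have key : dotProduct (star x) ((zetaScrewHankel n).mulVec x) =
        ∑ i : Fin (n + 1), ∑ j : Fin (n + 1), x i * zetaScrewMoment ((i : ℕ) + (j : ℕ)) * x j := by
      simp only [dotProduct, Matrix.mulVec, Pi.star_apply, star_trivial, zetaScrewHankel,
        Matrix.of_apply, Finset.mul_sum]
      refine Finset.sum_congr rfl fun i _ ↦ Finset.sum_congr rfl fun j _ ↦ ?_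
      ring
    rw [key]
    simpa using h n 0 x (by norm_num)
  · refine Matrix.PosSemidef.of_dotProduct_mulVec_nonneg
      (ZetaScrewGrowth.isHermitian_zetaScrewHankelShift n) fun x ↦ ?_
    have key : dotProduct (star x) ((zetaScrewHankelShift n).mulVec x) =
        ∑ i : Fin (n + 1), ∑ j : Fin (n + 1), x i * zetaScrewMoment ((i : ℕ) + (j : ℕ) + 1) * x j := by
      simp only [dotProduct, Matrix.mulVec, Pi.star_apply, star_trivial, zetaScrewHankelShift,
        Matrix.of_apply, Finset.mul_sum]
      refine Finset.sum_congr rfl fun i _ ↦ Finset.sum_congr rfl fun j _ ↦ ?_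
      ring
    rw [key]
    exact h n 1 x le_rfl

/-- RH-EQUIVALENT (line 1). **Thm 1.8 as Stieltjes positivity of the moment functional**
(via `ZetaScrewGrowth.hankel_quadForm_eq`): `RH ⟺` for every real polynomial
`q(t) = ∑ᵢ xᵢtⁱ`, `∫₀^∞ 4^{-1}e^{-t/2}Ψ(t)q(t)²dt ≥ 0` and `∫₀^∞ 4^{-1}e^{-t/2}Ψ(t)·t·q(t)²dt ≥ 0` —
the discretisation of Thm 1.7 (`Ψ ≥ 0`) that Thm 1.8 intends. WHAT THIS IS NOT: a criterion, not
a proof of RH. [cite: Suzuki2023, Thm 1.8, pp. 3–4 and §7.3, p. 17] -/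
theorem riemannHypothesis_iff_momentFunctional_nonneg :
    RiemannHypothesis ↔ ∀ (n : ℕ) (x : Fin (n + 1) → ℝ),
      0 ≤ ∫ t in Set.Ioi (0 : ℝ), 4⁻¹ * Real.exp (-(t / 2)) * zetaScrew t *
        (∑ i : Fin (n + 1), x i * t ^ (i : ℕ)) ^ 2 ∧
      0 ≤ ∫ t in Set.Ioi (0 : ℝ), 4⁻¹ * Real.exp (-(t / 2)) * zetaScrew t * t *
        (∑ i : Fin (n + 1), x i * t ^ (i : ℕ)) ^ 2 := by
  rw [riemannHypothesis_iff_hankelForms_nonneg]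
  have h0 : ∀ (n : ℕ) (x : Fin (n + 1) → ℝ),
      ∑ i : Fin (n + 1), ∑ j : Fin (n + 1), x i * zetaScrewMoment ((i : ℕ) + (j : ℕ) + 0) * x j =
      ∫ t in Set.Ioi (0 : ℝ), 4⁻¹ * Real.exp (-(t / 2)) * zetaScrew t *
        (∑ i : Fin (n + 1), x i * t ^ (i : ℕ)) ^ 2 := by
    intro n x
    rw [ZetaScrewGrowth.hankel_quadForm_eq]
    simp only [pow_zero, mul_one]
  have h1 : ∀ (n : ℕ) (x : Fin (n + 1) → ℝ),
      ∑ i : Fin (n + 1), ∑ j : Fin (n + 1), x i * zetaScrewMoment ((i : ℕ) + (j : ℕ) + 1) * x j =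
      ∫ t in Set.Ioi (0 : ℝ), 4⁻¹ * Real.exp (-(t / 2)) * zetaScrew t * t *
        (∑ i : Fin (n + 1), x i * t ^ (i : ℕ)) ^ 2 := by
    intro n x
    rw [ZetaScrewGrowth.hankel_quadForm_eq]
    simp only [pow_one]
  constructor
  · intro h n x
    exact ⟨(h0 n x) ▸ h n 0 x (by norm_num), (h1 n x) ▸ h n 1 x le_rfl⟩
  · intro h n s x hs
    rcases Nat.le_one_iff_eq_zero_or_eq_one.1 hs with rfl | rfl
    · rw [h0]; exact (h n x).1
    · rw [h1]; exact (h n x).2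

end Literature.NumberTheory.LFunctions
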